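import Summits.QuantumFields.YangMills.Theorems.UnitScaleTiltHistoryTailOneSupplierKinematic
import Summits.QuantumFields.YangMills.Theorems.UnitScaleTiltMinimiserStabilityRegPrAttainmentOfExistence
import HarnessLib

/-!
# `UnitScaleTiltHistoryTailOneSupplierV9` — `HistoryTailL` FROM 19200 v9's TWO LOAD-BEARING LEAVES `stub_halvingStep` (H) AND `stub_existenceMinimalOrbit` (EX) AND THE
# SUPPLIER ROWS, BY NAME (crux stmt-QuantumFields-19936, skeleton v5p9 ∕ 2′χ; cell `ym3-torus`, width seat `ym-ust-19936-w5` (g0); sixth file of the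
# `…HistoryTailOneSupplier` group — the v9 twin asked for by ★★OWNER g24 01:06:51Z (a))

WHAT.  OWNER RULING g24-№3′ (C4b filed) re-registers 19200's skeleton as v9 = {`stub_halvingStep`, `stub_PV3A`, `stub_PV3Cuniq`, `stub_existenceMinimalOrbit`}; by ★w2-19200 g0's
FINDING #4 the composition to T8 reads Prop. 7's existence clause (ii) ONLY, and ym-ust-20520-w4 g0 landed exactly that: `AttainmentOfExistence.thm1In8GlobalMin_of_halvingStep_of_existence :
⟨stub_halvingStep TEXT⟩ → ⟨stub_existenceMinimalOrbit TEXT⟩ → ⟨v5kC's T8 TEXT⟩` (halving ⟹ Prop. 8 ⟹ with EX attainment over (6); Prop. 8 ⟹ (8) for every minimiser).  Composed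
with this seat's `historyTailL_of_thm1In8_rows_allL` ∕ `historyTailL_of_thm1In8_kinematicLift_dataRows_allL` it gives the SHARPEST by-name reading of what
stmt-QuantumFields-19936 needs from 19200: **H and EX only** — NEITHER `stub_PV3A` ([B8] Thm 2, W-19200-T2) NOR `stub_PV3Cuniq` is on 19936's path.
* `historyTailL_of_halving_exist_rows_allL` : ⟨H⟩ → ⟨EX⟩ → (∀ odd `L > 1`, the supplier rows, (FL) as `InnerFineLiftsT3 … B₃`) → `HistoryTailL`;
* `historyTailL_of_halving_exist_kinematicLift_dataRows_allL` : ⟨H⟩ → ⟨EX⟩ → (∀ odd `L > 1`, ONE record-free kinematic lift theorem KIN) → (∀ odd `L > 1`, the (O″χ) rows) → `HistoryTailL`.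
(The four-leaf form over `thm1In8GlobalMin_of_v9Leaves` — idle leaves A∕Cuniq carried for stub-credit bookkeeping — is the same one-liner once ★r1 g5's twin lands.)
HONEST FRAMING: composition of landed theorems; H, EX, KIN∕(FL) and the χ data rows are HYPOTHESES (their texts verbatim), none asserted; def-free; count-neutral helper
(`--supports stmt-QuantumFields-19936`); registry untouched.  YM₃ on the three-torus is rung R3 of the programme, NOT the Clay problem: nothing here bears on d = 4, infinite
volume, or a mass gap.

References: T. Bałaban, Commun. Math. Phys. 102 (1985) 277–309 [Balaban1985Variational] (Thm 1 (8) p.279, (14) p.280, Prop. 7 p.299, Prop. 8 ∕ Sect. F p.304); Commun. Math.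
Phys. 102 (1985) 255–275 [Balaban1985UV3] ((5) p.256, (47) p.267, (71) p.273, Thm 2 p.272); C. King, Commun. Math. Phys. 102 (1986) 649–677 [King1986] ((3.12) p.657).
-/

set_option autoImplicit false

noncomputable section

namespace Summit.QuantumFields.YangMills.Theorems.HistoryTailOneSupplier

open MeasureTheory Set
open scoped Matrix.Norms.L2Operator
open Literature.MathematicalPhysics.QuantumFieldTheory.Balaban1983to89
open Literature.MathematicalPhysics.QuantumFieldTheory.Balaban1983to89.T3ContinuumYM3Torus
open Literature.MathematicalPhysics.QuantumFieldTheory.Balaban1983to89.T3UnitLawDensityEML (ℰp)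
open Literature.MathematicalPhysics.QuantumFieldTheory.Balaban1983to89.T3UnitScaleTilt (θBal)
open Literature.MathematicalPhysics.QuantumFieldTheory.Balaban1983to89.T3InteriorExcision
open Literature.MathematicalPhysics.QuantumFieldTheory.Balaban1983to89.T3PrintedRegularMinimiser
open Literature.MathematicalPhysics.QuantumFieldTheory.Balaban1983to89.T3PrintedMinimiserExistence
open Literature.MathematicalPhysics.QuantumFieldTheory.Balaban1983to89.T3ConstrainedMinimiser (fibre)
open Literature.MathematicalPhysics.QuantumFieldTheory.Balaban1983to89.T3LowerAlongMinimisersSplit (MinimisersIn8At)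
open Literature.MathematicalPhysics.QuantumFieldTheory.Balaban1983to89.T3Thm1Carrier (famX Idx)
open Literature.MathematicalPhysics.QuantumFieldTheory.Balaban1983to89.ExpMeanLog (deltaSU)
open Literature.MathematicalPhysics.QuantumFieldTheory.Balaban1983to89.B10Eq38TorusDomains (plaqsIn toFine)
open Literature.MathematicalPhysics.QuantumFieldTheory.Balaban1983to89.B10Eq42TorusConstraint (bondsIn)
open Literature.MathematicalPhysics.QuantumFieldTheory.Balaban1985CMP102.Setting
open Summit.QuantumFields.Balaban3D.Carriers
open Summit.QuantumFields.Balaban3D.Proofs.Primitives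
open Summit.QuantumFields.Balaban3D.Proofs.Thresholds (Q0)
open B7Prop2Explicit (C0)
open Summit.QuantumFields.YangMills.Theorems.AttainmentOfExistence (thm1In8GlobalMin_of_halvingStep_of_existence)

/-- ★★★ **`HistoryTailL` FROM 19200 v9's LEAVES H AND EX AND THE SUPPLIER ROWS** ((FL) as `InnerFineLiftsT3 … B₃`):
`historyTailL_of_thm1In8_rows_allL ∘ AttainmentOfExistence.thm1In8GlobalMin_of_halvingStep_of_existence`.
[cite: Balaban1985Variational, Thm 1 (8) p.279, Prop. 7 p.299, Prop. 8 p.304; Balaban1985UV3, (5) p.256, (47) p.267, (71) p.273, Thm 2 p.272; King1986, (3.12) p.657] -/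
theorem historyTailL_of_halving_exist_rows_allL
    (hH : ∀ (L : ℕ), 1 < L → ∃ B₃ : ℝ, 4 < B₃ ∧ ∃ a₅ : ℝ, 0 < a₅ ∧
      ∀ (i : Idx L) (ε₀ ε₁ : ℝ), 0 < ε₁ → ∀ (V : (famX L i).Bdry) (U : (famX L i).Cfg), (famX L i).Reg7 ε₁ V → (famX L i).InU ε₀ U →
        (famX L i).InB V U → (famX L i).IsCritical V U → ε₀ ≤ a₅ → (famX L i).InU (max (B₃ * ε₁) (ε₀ / 2)) U)
    (hEX : ∀ (L : ℕ), 1 < L → ∀ (B₃ : ℝ), 4 < B₃ → ∃ a₁' O₁ : ℝ, 0 < a₁' ∧ 1 ≤ O₁ ∧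
      ∀ (F : T3Family), F.L = L → ∀ (n K : ℕ) (hnK : n < K) (ε₁ : ℝ), 0 < ε₁ →
        ∀ V : GaugeField (F.P n) 0 (Matrix.specialUnitaryGroup (Fin 2) ℂ), PlaqSmall ε₁ V →
          ∀ U₀ : GaugeField (F.P K) 0 (Matrix.specialUnitaryGroup (Fin 2) ℂ), RegPr F n K ((L : ℝ) ^ 3 * B₃ * ε₁) U₀ → U₀ ∈ fibre F ℰp n K hnK.le V →
            ε₁ ≤ a₁' → ∃ U ∈ regFibrePr F n K hnK.le (O₁ * (L : ℝ) ^ 3 * B₃ * ε₁) V,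
              IsMinOn (fun W : GaugeField (F.P K) 0 (Matrix.specialUnitaryGroup (Fin 2) ℂ) => wilsonAction4 W)
                (regFibrePr F n K hnK.le (O₁ * (L : ℝ) ^ 3 * B₃ * ε₁) V) U)
    (hrows : ∀ L : ℕ, Odd L → 1 < L → ∃ (B₀ A₀ A₁ : ℝ), 0 < A₀ ∧ 0 < A₁ ∧
      ∀ (B a₀ a₁ : ℝ), B₀ ≤ B → 1 ≤ 2 * B → 0 < a₀ → a₀ ≤ A₀ → 0 < a₁ → a₁ ≤ A₁ → B * a₁ ≤ a₀ →
        (143 * ((((3 + 4 : ℕ) : ℝ)) ^ 2 / 4) ^ 2) * (2 * (B * a₁)) ≤ 1 / 3 →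
        2 * (2 * (B * a₁)) ≤ 2 * deltaSU (Fin 2) / (((3 + 4) * L : ℕ) : ℝ) ^ 2 →
        Thm1GlobalMinAt L a₀ a₁ B →
        ∃ (b₁ p₁ : ℝ), ∀ (b₀ p₀ : ℝ), b₁ ≤ b₀ → p₁ ≤ p₀ →
          ∃ 𝔠 : AlphaConsts L (suGroupModel 2).N, 𝔠.b₀ = b₀ ∧ 𝔠.p₀ = p₀ ∧ 𝔠.B₃ = B ∧
            4 * 𝔠.B₃ * (L : ℝ) ^ 2 * avgWindowFactor L ≤ 𝔠.C68 ∧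
            Real.exp (𝔠.p₀ - 1) ≤ 3 * C0 3 * 𝔠.C68 * (𝔠.b₀ * Q0 𝔠.p₀) ∧
            (𝔠.b₀ * Q0 𝔠.p₀) * (2 * (L : ℝ) ^ 2 * avgWindowFactor L) ^ 2 ≤ 3 * C0 3 * 𝔠.C68 * a₁ ^ 2 ∧
            7 * L + 3 ≤ 𝔠.M₁ ∧
            ∀ (F : T3Family) (hF : F.L = L),
              (∀ (γ : ℝ) (hγ : 0 < γ) (hγ1 : γ ≤ (min (hF ▸ 𝔠).gamma0 1) ^ 2) (K : ℕ),
                AlphaInputsT3AC.InnerFineLiftsT3 F (hF ▸ 𝔠) γ hγ hγ1 K (hF ▸ 𝔠).B₃) ∧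
              (∀ (γ : ℝ) (hγ : 0 < γ) (hγ1 : γ ≤ (min (hF ▸ 𝔠).gamma0 1) ^ 2) (K : ℕ),
                (∃ Ut : (k : ℕ) → GaugeField (F.P K) k (Matrix.specialUnitaryGroup (Fin 2) ℂ) →
                    GaugeField (F.P K) 0 (Matrix.specialUnitaryGroup (Fin 2) ℂ),
                  AlphaInputsT3AC.TrivMinimiserRowsT3 F (hF ▸ 𝔠) γ hγ hγ1 a₀ a₁ K Ut) →
                ∃ Ut : (k : ℕ) → GaugeField (F.P K) k (Matrix.specialUnitaryGroup (Fin 2) ℂ) →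
                    GaugeField (F.P K) 0 (Matrix.specialUnitaryGroup (Fin 2) ℂ),
                  AlphaInputsT3AC.TrivMinimiserRowsT3 F (hF ▸ 𝔠) γ hγ hγ1 a₀ a₁ K Ut ∧
                    AlphaInputsT3AC.DataRowsT3XChi F (hF ▸ 𝔠) γ hγ hγ1 K Ut)) :
    Summit.QuantumFields.YangMills.Theses.UnitScaleTilt.HistoryTailL :=
  historyTailL_of_thm1In8_rows_allL (thm1In8GlobalMin_of_halvingStep_of_existence hH hEX) hrows

/-- ★★★ **`HistoryTailL` FROM 19200 v9's LEAVES H AND EX, ONE RECORD-FREE KINEMATIC LIFT THEOREM PER ODD BLOCK SIZE, AND THE (O″χ) ROWS** — the three independently owned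
deliverables of DEPMAP v3.5 for 19936 with the (T) arrow read from the two load-bearing leaves only:
`historyTailL_of_thm1In8_kinematicLift_dataRows_allL ∘ AttainmentOfExistence.thm1In8GlobalMin_of_halvingStep_of_existence`.
[cite: Balaban1985Variational, Thm 1 (8) p.279, (2)+(8) pp.278–279, Prop. 7 p.299, Prop. 8 p.304; Balaban1985UV3, (5) p.256, (39)–(42) p.266, (47) p.267, (71) p.273, Thm 2 p.272; King1986, (3.12) p.657] -/
theorem historyTailL_of_halving_exist_kinematicLift_dataRows_allL
    (hH : ∀ (L : ℕ), 1 < L → ∃ B₃ : ℝ, 4 < B₃ ∧ ∃ a₅ : ℝ, 0 < a₅ ∧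
      ∀ (i : Idx L) (ε₀ ε₁ : ℝ), 0 < ε₁ → ∀ (V : (famX L i).Bdry) (U : (famX L i).Cfg), (famX L i).Reg7 ε₁ V → (famX L i).InU ε₀ U →
        (famX L i).InB V U → (famX L i).IsCritical V U → ε₀ ≤ a₅ → (famX L i).InU (max (B₃ * ε₁) (ε₀ / 2)) U)
    (hEX : ∀ (L : ℕ), 1 < L → ∀ (B₃ : ℝ), 4 < B₃ → ∃ a₁' O₁ : ℝ, 0 < a₁' ∧ 1 ≤ O₁ ∧
      ∀ (F : T3Family), F.L = L → ∀ (n K : ℕ) (hnK : n < K) (ε₁ : ℝ), 0 < ε₁ →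
        ∀ V : GaugeField (F.P n) 0 (Matrix.specialUnitaryGroup (Fin 2) ℂ), PlaqSmall ε₁ V →
          ∀ U₀ : GaugeField (F.P K) 0 (Matrix.specialUnitaryGroup (Fin 2) ℂ), RegPr F n K ((L : ℝ) ^ 3 * B₃ * ε₁) U₀ → U₀ ∈ fibre F ℰp n K hnK.le V →
            ε₁ ≤ a₁' → ∃ U ∈ regFibrePr F n K hnK.le (O₁ * (L : ℝ) ^ 3 * B₃ * ε₁) V,
              IsMinOn (fun W : GaugeField (F.P K) 0 (Matrix.specialUnitaryGroup (Fin 2) ℂ) => wilsonAction4 W)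
                (regFibrePr F n K hnK.le (O₁ * (L : ℝ) ^ 3 * B₃ * ε₁) V) U)
    (hkin : ∀ L : ℕ, Odd L → 1 < L → ∃ (B_K η : ℝ), 0 < η ∧
      ∀ (F : T3Family) (_hF : F.L = L) (K : ℕ), ∀ (k : ℕ), k ≤ K → ∀ (Ω : Set (Site (F.P K) 0)), (∀ w : Site (F.P K) 0, w ∈ Ω ↔ toFine k (coarsen k w) ∈ Ω) →
        ∀ (ε : ℝ), 0 < ε → ε ≤ η → ∀ (W : GaugeField (F.P K) k (Matrix.specialUnitaryGroup (Fin 2) ℂ)), PlaqSmallOn (↑(plaqsIn k Ω)) ε W →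
          ∃ U : GaugeField (F.P K) 0 (Matrix.specialUnitaryGroup (Fin 2) ℂ),
            (∀ b : PBond (F.P K) k, b ∈ bondsIn k Ω → Averaging.iter (fun i => BlockAveraging.blockAvg (P := F.P K) (j := i) ℰp) k U b = W b) ∧
            ∀ q : Plaq (F.P K) 0, q ∈ plaqsIn 0 Ω → GaugeGroup.dist1 (GaugeField.plaqHol U q) < B_K * ε * (((F.L : ℝ) ^ k)⁻¹) ^ 2)
    (hO : ∀ L : ℕ, Odd L → 1 < L → ∃ (B₀ A₀ A₁ : ℝ), 0 < A₀ ∧ 0 < A₁ ∧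
      ∀ (B a₀ a₁ : ℝ), B₀ ≤ B → 1 ≤ 2 * B → 0 < a₀ → a₀ ≤ A₀ → 0 < a₁ → a₁ ≤ A₁ → B * a₁ ≤ a₀ →
        (143 * ((((3 + 4 : ℕ) : ℝ)) ^ 2 / 4) ^ 2) * (2 * (B * a₁)) ≤ 1 / 3 →
        2 * (2 * (B * a₁)) ≤ 2 * deltaSU (Fin 2) / (((3 + 4) * L : ℕ) : ℝ) ^ 2 →
        Thm1GlobalMinAt L a₀ a₁ B →
        ∃ (b₁ p₁ : ℝ), ∀ (b₀ p₀ : ℝ), b₁ ≤ b₀ → p₁ ≤ p₀ →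
          ∃ 𝔠 : AlphaConsts L (suGroupModel 2).N, 𝔠.b₀ = b₀ ∧ 𝔠.p₀ = p₀ ∧ 𝔠.B₃ = B ∧
            4 * 𝔠.B₃ * (L : ℝ) ^ 2 * avgWindowFactor L ≤ 𝔠.C68 ∧
            Real.exp (𝔠.p₀ - 1) ≤ 3 * C0 3 * 𝔠.C68 * (𝔠.b₀ * Q0 𝔠.p₀) ∧
            (𝔠.b₀ * Q0 𝔠.p₀) * (2 * (L : ℝ) ^ 2 * avgWindowFactor L) ^ 2 ≤ 3 * C0 3 * 𝔠.C68 * a₁ ^ 2 ∧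
            7 * L + 3 ≤ 𝔠.M₁ ∧
            ∀ (F : T3Family) (hF : F.L = L),
              (∀ (γ : ℝ) (hγ : 0 < γ) (hγ1 : γ ≤ (min (hF ▸ 𝔠).gamma0 1) ^ 2) (K : ℕ),
                (∃ Ut : (k : ℕ) → GaugeField (F.P K) k (Matrix.specialUnitaryGroup (Fin 2) ℂ) →
                    GaugeField (F.P K) 0 (Matrix.specialUnitaryGroup (Fin 2) ℂ),
                  AlphaInputsT3AC.TrivMinimiserRowsT3 F (hF ▸ 𝔠) γ hγ hγ1 a₀ a₁ K Ut) →
                ∃ Ut : (k : ℕ) → GaugeField (F.P K) k (Matrix.specialUnitaryGroup (Fin 2) ℂ) →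
                    GaugeField (F.P K) 0 (Matrix.specialUnitaryGroup (Fin 2) ℂ),
                  AlphaInputsT3AC.TrivMinimiserRowsT3 F (hF ▸ 𝔠) γ hγ hγ1 a₀ a₁ K Ut ∧
                    AlphaInputsT3AC.DataRowsT3XChi F (hF ▸ 𝔠) γ hγ hγ1 K Ut)) :
    Summit.QuantumFields.YangMills.Theses.UnitScaleTilt.HistoryTailL :=
  historyTailL_of_thm1In8_kinematicLift_dataRows_allL (thm1In8GlobalMin_of_halvingStep_of_existence hH hEX) hkin hO


/-! ## §2 The same under the names of OWNER RULING g24-№5 (the 19200 skeleton of record is the TWO-STUB v10 {`stub_halvingStep`, `stub_existenceMinimalOrbit`}; DEPMAP v3.6 «(T) ⇐ {H, EX}») -/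

/-- ★★★ **`historyTailL_of_v10Leaves_rows_allL`** — the name asked for by ★★OWNER g24 (RULING №5 (5)): `HistoryTailL` ⇐ ⟨v10 `stub_halvingStep`⟩ ∧ ⟨v10 `stub_existenceMinimalOrbit`⟩ ∧
(∀ odd `L > 1`, the supplier rows); = `historyTailL_of_halving_exist_rows_allL` (v10's two stub texts are v9's H and EX verbatim).
[cite: Balaban1985Variational, Thm 1 (8) p.279, Prop. 7 p.299, Prop. 8 p.304; Balaban1985UV3, (5) p.256, (47) p.267, (71) p.273, Thm 2 p.272; King1986, (3.12) p.657] -/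
theorem historyTailL_of_v10Leaves_rows_allL
    (hH : ∀ (L : ℕ), 1 < L → ∃ B₃ : ℝ, 4 < B₃ ∧ ∃ a₅ : ℝ, 0 < a₅ ∧
      ∀ (i : Idx L) (ε₀ ε₁ : ℝ), 0 < ε₁ → ∀ (V : (famX L i).Bdry) (U : (famX L i).Cfg), (famX L i).Reg7 ε₁ V → (famX L i).InU ε₀ U →
        (famX L i).InB V U → (famX L i).IsCritical V U → ε₀ ≤ a₅ → (famX L i).InU (max (B₃ * ε₁) (ε₀ / 2)) U)
    (hEX : ∀ (L : ℕ), 1 < L → ∀ (B₃ : ℝ), 4 < B₃ → ∃ a₁' O₁ : ℝ, 0 < a₁' ∧ 1 ≤ O₁ ∧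
      ∀ (F : T3Family), F.L = L → ∀ (n K : ℕ) (hnK : n < K) (ε₁ : ℝ), 0 < ε₁ →
        ∀ V : GaugeField (F.P n) 0 (Matrix.specialUnitaryGroup (Fin 2) ℂ), PlaqSmall ε₁ V →
          ∀ U₀ : GaugeField (F.P K) 0 (Matrix.specialUnitaryGroup (Fin 2) ℂ), RegPr F n K ((L : ℝ) ^ 3 * B₃ * ε₁) U₀ → U₀ ∈ fibre F ℰp n K hnK.le V →
            ε₁ ≤ a₁' → ∃ U ∈ regFibrePr F n K hnK.le (O₁ * (L : ℝ) ^ 3 * B₃ * ε₁) V,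
              IsMinOn (fun W : GaugeField (F.P K) 0 (Matrix.specialUnitaryGroup (Fin 2) ℂ) => wilsonAction4 W)
                (regFibrePr F n K hnK.le (O₁ * (L : ℝ) ^ 3 * B₃ * ε₁) V) U)
    (hrows : ∀ L : ℕ, Odd L → 1 < L → ∃ (B₀ A₀ A₁ : ℝ), 0 < A₀ ∧ 0 < A₁ ∧
      ∀ (B a₀ a₁ : ℝ), B₀ ≤ B → 1 ≤ 2 * B → 0 < a₀ → a₀ ≤ A₀ → 0 < a₁ → a₁ ≤ A₁ → B * a₁ ≤ a₀ →
        (143 * ((((3 + 4 : ℕ) : ℝ)) ^ 2 / 4) ^ 2) * (2 * (B * a₁)) ≤ 1 / 3 →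
        2 * (2 * (B * a₁)) ≤ 2 * deltaSU (Fin 2) / (((3 + 4) * L : ℕ) : ℝ) ^ 2 →
        Thm1GlobalMinAt L a₀ a₁ B →
        ∃ (b₁ p₁ : ℝ), ∀ (b₀ p₀ : ℝ), b₁ ≤ b₀ → p₁ ≤ p₀ →
          ∃ 𝔠 : AlphaConsts L (suGroupModel 2).N, 𝔠.b₀ = b₀ ∧ 𝔠.p₀ = p₀ ∧ 𝔠.B₃ = B ∧
            4 * 𝔠.B₃ * (L : ℝ) ^ 2 * avgWindowFactor L ≤ 𝔠.C68 ∧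
            Real.exp (𝔠.p₀ - 1) ≤ 3 * C0 3 * 𝔠.C68 * (𝔠.b₀ * Q0 𝔠.p₀) ∧
            (𝔠.b₀ * Q0 𝔠.p₀) * (2 * (L : ℝ) ^ 2 * avgWindowFactor L) ^ 2 ≤ 3 * C0 3 * 𝔠.C68 * a₁ ^ 2 ∧
            7 * L + 3 ≤ 𝔠.M₁ ∧
            ∀ (F : T3Family) (hF : F.L = L),
              (∀ (γ : ℝ) (hγ : 0 < γ) (hγ1 : γ ≤ (min (hF ▸ 𝔠).gamma0 1) ^ 2) (K : ℕ),
                AlphaInputsT3AC.InnerFineLiftsT3 F (hF ▸ 𝔠) γ hγ hγ1 K (hF ▸ 𝔠).B₃) ∧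
              (∀ (γ : ℝ) (hγ : 0 < γ) (hγ1 : γ ≤ (min (hF ▸ 𝔠).gamma0 1) ^ 2) (K : ℕ),
                (∃ Ut : (k : ℕ) → GaugeField (F.P K) k (Matrix.specialUnitaryGroup (Fin 2) ℂ) →
                    GaugeField (F.P K) 0 (Matrix.specialUnitaryGroup (Fin 2) ℂ),
                  AlphaInputsT3AC.TrivMinimiserRowsT3 F (hF ▸ 𝔠) γ hγ hγ1 a₀ a₁ K Ut) →
                ∃ Ut : (k : ℕ) → GaugeField (F.P K) k (Matrix.specialUnitaryGroup (Fin 2) ℂ) →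
                    GaugeField (F.P K) 0 (Matrix.specialUnitaryGroup (Fin 2) ℂ),
                  AlphaInputsT3AC.TrivMinimiserRowsT3 F (hF ▸ 𝔠) γ hγ hγ1 a₀ a₁ K Ut ∧
                    AlphaInputsT3AC.DataRowsT3XChi F (hF ▸ 𝔠) γ hγ hγ1 K Ut)) :
    Summit.QuantumFields.YangMills.Theses.UnitScaleTilt.HistoryTailL :=
  historyTailL_of_halving_exist_rows_allL hH hEX hrows

/-- ★★★ **`historyTailL_of_v10Leaves_kinematicLift_dataRows_allL`** — v10's two leaves, ONE record-free kinematic lift theorem per odd block size, the (O″χ) rows ⇒ `HistoryTailL`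
(= `historyTailL_of_halving_exist_kinematicLift_dataRows_allL`; DEPMAP v3.6 for 19936 as one kernel statement).
[cite: Balaban1985Variational, Thm 1 (8) p.279, (2)+(8) pp.278–279, Prop. 7 p.299, Prop. 8 p.304; Balaban1985UV3, (5) p.256, (39)–(42) p.266, (47) p.267, (71) p.273, Thm 2 p.272; King1986, (3.12) p.657] -/
theorem historyTailL_of_v10Leaves_kinematicLift_dataRows_allL
    (hH : ∀ (L : ℕ), 1 < L → ∃ B₃ : ℝ, 4 < B₃ ∧ ∃ a₅ : ℝ, 0 < a₅ ∧
      ∀ (i : Idx L) (ε₀ ε₁ : ℝ), 0 < ε₁ → ∀ (V : (famX L i).Bdry) (U : (famX L i).Cfg), (famX L i).Reg7 ε₁ V → (famX L i).InU ε₀ U →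
        (famX L i).InB V U → (famX L i).IsCritical V U → ε₀ ≤ a₅ → (famX L i).InU (max (B₃ * ε₁) (ε₀ / 2)) U)
    (hEX : ∀ (L : ℕ), 1 < L → ∀ (B₃ : ℝ), 4 < B₃ → ∃ a₁' O₁ : ℝ, 0 < a₁' ∧ 1 ≤ O₁ ∧
      ∀ (F : T3Family), F.L = L → ∀ (n K : ℕ) (hnK : n < K) (ε₁ : ℝ), 0 < ε₁ →
        ∀ V : GaugeField (F.P n) 0 (Matrix.specialUnitaryGroup (Fin 2) ℂ), PlaqSmall ε₁ V →
          ∀ U₀ : GaugeField (F.P K) 0 (Matrix.specialUnitaryGroup (Fin 2) ℂ), RegPr F n K ((L : ℝ) ^ 3 * B₃ * ε₁) U₀ → U₀ ∈ fibre F ℰp n K hnK.le V →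
            ε₁ ≤ a₁' → ∃ U ∈ regFibrePr F n K hnK.le (O₁ * (L : ℝ) ^ 3 * B₃ * ε₁) V,
              IsMinOn (fun W : GaugeField (F.P K) 0 (Matrix.specialUnitaryGroup (Fin 2) ℂ) => wilsonAction4 W)
                (regFibrePr F n K hnK.le (O₁ * (L : ℝ) ^ 3 * B₃ * ε₁) V) U)
    (hkin : ∀ L : ℕ, Odd L → 1 < L → ∃ (B_K η : ℝ), 0 < η ∧
      ∀ (F : T3Family) (_hF : F.L = L) (K : ℕ), ∀ (k : ℕ), k ≤ K → ∀ (Ω : Set (Site (F.P K) 0)), (∀ w : Site (F.P K) 0, w ∈ Ω ↔ toFine k (coarsen k w) ∈ Ω) →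
        ∀ (ε : ℝ), 0 < ε → ε ≤ η → ∀ (W : GaugeField (F.P K) k (Matrix.specialUnitaryGroup (Fin 2) ℂ)), PlaqSmallOn (↑(plaqsIn k Ω)) ε W →
          ∃ U : GaugeField (F.P K) 0 (Matrix.specialUnitaryGroup (Fin 2) ℂ),
            (∀ b : PBond (F.P K) k, b ∈ bondsIn k Ω → Averaging.iter (fun i => BlockAveraging.blockAvg (P := F.P K) (j := i) ℰp) k U b = W b) ∧
            ∀ q : Plaq (F.P K) 0, q ∈ plaqsIn 0 Ω → GaugeGroup.dist1 (GaugeField.plaqHol U q) < B_K * ε * (((F.L : ℝ) ^ k)⁻¹) ^ 2)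
    (hO : ∀ L : ℕ, Odd L → 1 < L → ∃ (B₀ A₀ A₁ : ℝ), 0 < A₀ ∧ 0 < A₁ ∧
      ∀ (B a₀ a₁ : ℝ), B₀ ≤ B → 1 ≤ 2 * B → 0 < a₀ → a₀ ≤ A₀ → 0 < a₁ → a₁ ≤ A₁ → B * a₁ ≤ a₀ →
        (143 * ((((3 + 4 : ℕ) : ℝ)) ^ 2 / 4) ^ 2) * (2 * (B * a₁)) ≤ 1 / 3 →
        2 * (2 * (B * a₁)) ≤ 2 * deltaSU (Fin 2) / (((3 + 4) * L : ℕ) : ℝ) ^ 2 →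
        Thm1GlobalMinAt L a₀ a₁ B →
        ∃ (b₁ p₁ : ℝ), ∀ (b₀ p₀ : ℝ), b₁ ≤ b₀ → p₁ ≤ p₀ →
          ∃ 𝔠 : AlphaConsts L (suGroupModel 2).N, 𝔠.b₀ = b₀ ∧ 𝔠.p₀ = p₀ ∧ 𝔠.B₃ = B ∧
            4 * 𝔠.B₃ * (L : ℝ) ^ 2 * avgWindowFactor L ≤ 𝔠.C68 ∧
            Real.exp (𝔠.p₀ - 1) ≤ 3 * C0 3 * 𝔠.C68 * (𝔠.b₀ * Q0 𝔠.p₀) ∧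
            (𝔠.b₀ * Q0 𝔠.p₀) * (2 * (L : ℝ) ^ 2 * avgWindowFactor L) ^ 2 ≤ 3 * C0 3 * 𝔠.C68 * a₁ ^ 2 ∧
            7 * L + 3 ≤ 𝔠.M₁ ∧
            ∀ (F : T3Family) (hF : F.L = L),
              (∀ (γ : ℝ) (hγ : 0 < γ) (hγ1 : γ ≤ (min (hF ▸ 𝔠).gamma0 1) ^ 2) (K : ℕ),
                (∃ Ut : (k : ℕ) → GaugeField (F.P K) k (Matrix.specialUnitaryGroup (Fin 2) ℂ) →
                    GaugeField (F.P K) 0 (Matrix.specialUnitaryGroup (Fin 2) ℂ),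
                  AlphaInputsT3AC.TrivMinimiserRowsT3 F (hF ▸ 𝔠) γ hγ hγ1 a₀ a₁ K Ut) →
                ∃ Ut : (k : ℕ) → GaugeField (F.P K) k (Matrix.specialUnitaryGroup (Fin 2) ℂ) →
                    GaugeField (F.P K) 0 (Matrix.specialUnitaryGroup (Fin 2) ℂ),
                  AlphaInputsT3AC.TrivMinimiserRowsT3 F (hF ▸ 𝔠) γ hγ hγ1 a₀ a₁ K Ut ∧
                    AlphaInputsT3AC.DataRowsT3XChi F (hF ▸ 𝔠) γ hγ hγ1 K Ut)) :
    Summit.QuantumFields.YangMills.Theses.UnitScaleTilt.HistoryTailL :=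
  historyTailL_of_halving_exist_kinematicLift_dataRows_allL hH hEX hkin hO

end Summit.QuantumFields.YangMills.Theorems.HistoryTailOneSupplier

end
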